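import Mathlib

/-!
# SoloBlindTheta0Units — the characteristic-5 identities behind THEOREM Θ₀-35 (solo-blind s142)

WILD88, proviso P4, zone A, the *nilpotent tie* `Θ₀`: second-block deviation at half the depth of
the K-digit, Artin–Schreier matrix singular (`e₊ e₋ = 4 q²`) and nilpotent (`(e₋/q)⁶ = 1`), where
`e₊, e₋` are the two characters of the K-digit and `q = q₂(Ḡ)` the quadratic invariant of the
second-block digit (memo `HOME/work/s142/dled.md §5′`, claims SB-C1137/SB-C1138).

On `Θ₀` one writes `e₋ = ζ q`, `e₊ = 4 q / ζ` with `ζ⁶ = 1`; the kernel slope of the reduced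
satellite line `y = μ x` is `μ = 2 ζ`.  The on-shell elimination of THEOREM Θ₀-35 then produces the
one-variable equation `F = x⁵ (μ⁶ + 1)/μ + x²⁵/(2 q⁵) − 3 t x² (μ³ + 1)/μ + …` and the label
`ℓ₅ x⁵ + …` with `ℓ₅ ∝ 3 e₊² + q e₋ = 2 q² (1 − μ³)/μ²`.  The argument needs exactly the following
scalar facts, valid in every field of characteristic `5` (in the application `𝔽₂₅ ⊂ 𝔽₆₂₅`):

* the parametrisation satisfies the two defining conditions of `Θ₀` and the slope equation
  `μ⁵ e₋ = 2 q`, and gives `μ⁶ = 4` (`theta0_param`);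
* `μ⁶ = 4` forces `μ³ = 2 ∨ μ³ = −2`, `μ ≠ 0`, and `μ⁶ + 1 = 0` — the quintic term of `F` dies,
  which is the fat point (`mu_cube_of_mu_six`, `mu_ne_zero_of_mu_six`, `quintic_coeff_vanishes`);
* the two surviving leading coefficients are units: `μ³ + 1 ≠ 0` (the `t x²` term) and
  `1 − μ³ ≠ 0` (the label's `x⁵` term) (`ct_ne_zero`, `ell5_factor_ne_zero`);
* the label identity `μ² (3 e₊² + q e₋) = 2 q² (1 − μ³)` (`label_leading_identity`);
* `z ↦ z⁵` is injective on cyclic groups of order `24` and `23` (the two satellite circles),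
  i.e. `5` is coprime to `24` and `23` (`five_coprime_circle_orders`).

Everything is `ring`/`linear_combination`, characteristic bookkeeping via `CharP`, or `decide`.
-/

namespace Summit.HodgeConjecture.HodgeConjecture.Theorems

section CharFive

variable {F : Type*} [Field F] [CharP F 5]

/-- In characteristic `5`, `(5 : F) = 0`. -/
theorem five_eq_zero : (5 : F) = 0 := by
  simpa using CharP.cast_eq_zero F 5

/-- In characteristic `5`, `(2 : F) ≠ 0`. -/
theorem two_ne_zero' : (2 : F) ≠ 0 := by
  have h : ((2 : ℕ) : F) ≠ 0 := by
    rw [Ne, CharP.cast_eq_zero_iff F 5]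
    decide
  simpa using h

/-- In characteristic `5`, `(3 : F) ≠ 0`. -/
theorem three_ne_zero' : (3 : F) ≠ 0 := by
  have h : ((3 : ℕ) : F) ≠ 0 := by
    rw [Ne, CharP.cast_eq_zero_iff F 5]
    decide
  simpa using h

/-- In characteristic `5`, `(4 : F) ≠ 0`. -/
theorem four_ne_zero' : (4 : F) ≠ 0 := by
  have h : ((4 : ℕ) : F) ≠ 0 := by
    rw [Ne, CharP.cast_eq_zero_iff F 5]
    decide
  simpa using h

/-- The `Θ₀` parametrisation `e₋ = ζ q`, `e₊ = 4 q / ζ`, `μ = 2 ζ` with `ζ⁶ = 1`: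
it satisfies the singularity condition `e₊ e₋ = 4 q²`, the nilpotency condition `(e₋/q)⁶ = 1`,
the kernel-slope equation `μ⁵ e₋ = 2 q`, and `μ⁶ = 4`. -/
theorem theta0_param (ζ q : F) (hζ : ζ ^ 6 = 1) (hζ0 : ζ ≠ 0) (hq : q ≠ 0) :
    (4 * q / ζ) * (ζ * q) = 4 * q ^ 2 ∧ ((ζ * q) / q) ^ 6 = 1 ∧
      (2 * ζ) ^ 5 * (ζ * q) = 2 * q ∧ (2 * ζ) ^ 6 = 4 := by
  have h5 : (5 : F) = 0 := five_eq_zero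
  refine ⟨?_, ?_, ?_, ?_⟩
  · have : (4 * q / ζ) * (ζ * q) = 4 * q ^ 2 * (ζ / ζ) := by ring
    rw [this, div_self hζ0, mul_one]
  · rw [mul_div_assoc, div_self hq, mul_one, hζ]
  · have : (2 * ζ) ^ 5 * (ζ * q) = 32 * ζ ^ 6 * q := by ring
    rw [this, hζ]
    linear_combination (6 * q) * h5
  · have : (2 * ζ) ^ 6 = 64 * ζ ^ 6 := by ring
    rw [this, hζ]
    linear_combination (12 : F) * h5

omit [CharP F 5] in
/-- `μ⁶ = 4` forces `μ³ = 2` or `μ³ = −2`. -/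
theorem mu_cube_of_mu_six (μ : F) (h : μ ^ 6 = 4) : μ ^ 3 = 2 ∨ μ ^ 3 = -2 := by
  have hprod : (μ ^ 3 - 2) * (μ ^ 3 + 2) = 0 := by
    linear_combination h
  rcases mul_eq_zero.mp hprod with h1 | h2
  · exact Or.inl (sub_eq_zero.mp h1)
  · exact Or.inr (eq_neg_of_add_eq_zero_left h2)

/-- `μ⁶ = 4` forces `μ ≠ 0`. -/
theorem mu_ne_zero_of_mu_six (μ : F) (h : μ ^ 6 = 4) : μ ≠ 0 := by
  intro h0
  rw [h0] at h
  norm_num at h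
  exact four_ne_zero' h.symm

/-- The quintic coefficient `(μ⁶ + 1)/μ` of the on-shell equation vanishes on `Θ₀`:
`μ⁶ + 1 = 0` — the 25 satellites are infinitesimally close (one fat point). -/
theorem quintic_coeff_vanishes (μ : F) (h : μ ^ 6 = 4) : μ ^ 6 + 1 = 0 := by
  rw [h]
  have h5 : (5 : F) = 0 := five_eq_zero
  linear_combination h5

/-- The `t x²` coefficient `3 (μ³ + 1)/μ` is a unit: `μ³ + 1 ≠ 0`. -/
theorem ct_ne_zero (μ : F) (h : μ ^ 6 = 4) : μ ^ 3 + 1 ≠ 0 := by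
  rcases mu_cube_of_mu_six μ h with h3 | h3 <;> rw [h3]
  · norm_num
    exact three_ne_zero'
  · norm_num

/-- The label's leading factor `1 − μ³` is a unit. -/
theorem ell5_factor_ne_zero (μ : F) (h : μ ^ 6 = 4) : 1 - μ ^ 3 ≠ 0 := by
  rcases mu_cube_of_mu_six μ h with h3 | h3 <;> rw [h3]
  · norm_num
  · norm_num
    exact three_ne_zero'

/-- Both leading scalars together, with `3 ≠ 0` and `μ ≠ 0`: the coefficients
`3 (μ³ + 1)/μ` and `2 q² (1 − μ³)/μ²` (for `q ≠ 0`) are nonzero. -/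
theorem theta0_leading_units (μ q : F) (h : μ ^ 6 = 4) (hq : q ≠ 0) :
    3 * (μ ^ 3 + 1) / μ ≠ 0 ∧ 2 * q ^ 2 * (1 - μ ^ 3) / μ ^ 2 ≠ 0 := by
  have hμ := mu_ne_zero_of_mu_six μ h
  refine ⟨?_, ?_⟩
  · exact div_ne_zero (mul_ne_zero three_ne_zero' (ct_ne_zero μ h)) hμ
  · exact div_ne_zero (mul_ne_zero (mul_ne_zero two_ne_zero' (pow_ne_zero 2 hq))
      (ell5_factor_ne_zero μ h)) (pow_ne_zero 2 hμ)

/-- The label identity on `Θ₀`: with `e₊ = 4 q/ζ`, `e₋ = ζ q`, `μ = 2 ζ` one has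
`μ² (3 e₊² + q e₋) = 2 q² (1 − μ³)` (in characteristic `5`). -/
theorem label_leading_identity (ζ q : F) (hζ0 : ζ ≠ 0) :
    (2 * ζ) ^ 2 * (3 * (4 * q / ζ) ^ 2 + q * (ζ * q)) = 2 * q ^ 2 * (1 - (2 * ζ) ^ 3) := by
  have h5 : (5 : F) = 0 := five_eq_zero
  have key : (2 * ζ) ^ 2 * (3 * (4 * q / ζ) ^ 2 + q * (ζ * q))
      = 192 * q ^ 2 + 4 * q ^ 2 * ζ ^ 3 := by
    field_simp
    ring
  rw [key]
  linear_combination (38 * q ^ 2 + 4 * q ^ 2 * ζ ^ 3) * h5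

end CharFive

/-- `z ↦ z⁵` is a bijection on cyclic groups of order `24` and `23` (the two satellite circles of
THEOREM Θ₀-35): `5` is coprime to both orders. -/
theorem five_coprime_circle_orders : Nat.Coprime 5 24 ∧ Nat.Coprime 5 23 := by
  decide

/-- The circle orders: after centring at a satellite the remaining `24 = 25 − 1` satellites form one
group, or `1 + 23`; and `24 = |𝔽₂₅ˣ|`. -/
theorem circle_orders : 25 - 1 = 24 ∧ 24 = 1 + 23 ∧ 5 ^ 2 - 1 = 24 := by
  decide

end Summit.HodgeConjecture.HodgeConjecture.Theorems
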